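/-
Copyright (c) 2026 the pub-hodgecm-mathlib formalisation cell (harness21).  Prover seat hodgecm-mathlib-K2Liu-p01 (g7), Track B «K2-LIT»,
#184♮ = hLiu418 = `stmt-HodgeConjecture-24832`; LEAD F0P6-plan (g14) BATCH #2 10:50:47Z «(S4-nat)»; my census 11:01:35Z, brick (nat-0): the RATIONAL Levi-type model identification
`k_S : (x, y) ↦ (x, S y)` between the Schrödinger models of two Gram matrices `T′`, `T″ = T′·S` — ★ `LocalScaleModelTransport` with a MATRIX in place of the scalar `a`.
-/
import Literature.NumberTheory.GelbartRogawski1991.LocalScaleModelTransport   -- ★ the scalar twin (`lineScale`, `scaleTransportElt`); brings `LocalDoubledUnitaryDatum` (`deltaLagrangian`, `lagrangianY`, `toLin`), `ImplementerTransport`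
import HarnessLib

/-!
# Crux `HLiu418`, #42S organ S4, brick (nat-0): THE LEVI-TYPE MODEL TRANSPORT `k_S : (x, y) ↦ (x, S·y)` — the Schrödinger models of `T′` and `T″ = T′·S` AGREE ON THE NOSE, so
# `S̃p_ψ(𝕎_v, β_{T″}) →* S̃p_ψ(𝕎_v, β_{T′})` with the SAME operators

Cell `hodgecm-mathlib`, crux item hLiu418 = `stmt-HodgeConjecture-24832` (helper lane `--supports … --as helper`, count-neutral).  THEOREMS ONLY (no `def`, no instance, no notation,
no named-fact hypothesis, no `sorry`) — the transport is written with the tree's `symplecticConj` ∕ `LinearEquiv.prodCongr` ∕ `Matrix.toLinearEquiv'`, no new definition.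
GENERIC: a number field `F`, a finite place `v`, Gram matrices `T′, T″ ∈ M_N(F)` and a `v`-adic matrix `S_v` with `T′_v·S_v = T″_v` (for a RATIONAL `S` with `T′·S = T″`, `S_v = S ⊗ 1`,
`localGram_mul`; for symmetric invertible Gram matrices `S = T′⁻¹T″`; for the doubled K2Lit data of two auxiliary frames `dV′, dV″`: `S = 1_𝔻 ⊗ diag(d″ᵢ∕d′ᵢ) = S₀ ⊕ S₀`, so it preserves
`ℓ_Δ` — §4).  The Levi-type automorphism is any `k : 𝕎_v ≃ₗ 𝕎_v` with `k (x, y) = (x, S_v y)` (BY VALUE through `hk`; a witness is `1 × toLinearEquiv' S_v`, `exists_leviEquiv`).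

THE MATHEMATICS ([MoeglinVignerasWaldspurger1987, Chap. 2 I.4, II.1 (A)–(B)]; [Weil1964, n° 5, n° 34 «changement de base»]).  `β_T(x, y) = ⟨x, T_v y⟩` (★ `localPairing`), so
`β_{T′}(x, S_v y) = β_{T″}(x, y)`: the Levi-type automorphism `k_S = (1, S_v)` of `𝕎_v = X ⊕ Y` is an ISOMETRY `(𝕎_v, β_{T″}) → (𝕎_v, β_{T′})` fixing `X` pointwise, and the
Schrödinger operators (`Φ ↦ ψ(t + β(u, y))Φ(u + x)`, ★ `schrodingerSB_apply`) agree: **`ρ_{T″}(h) = ρ_{T′}(k_S h)`** on the SAME space `𝒮(F_vᴺ)`.  Hence (★ `implements_iff_implements_symplecticConj`)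
the same operator `M` implements `g` for `ρ_{T″}` iff it implements `k_S g k_S⁻¹` for `ρ_{T′}`, and `(g, M) ↦ (k_S g k_S⁻¹, M)` is a homomorphism `S̃p_ψ(β_{T″}) →* S̃p_ψ(β_{T′})` with
IDENTICAL Weil operators; it carries movers of `ℓ_Δ` onto `ℓ_Y` to movers when `k_S` preserves both Lagrangians.
* §1 `localGram_mul`, `localPairing_mulVec` (`β_{T′}(x, S_v y) = β_{T″}(x, y)`), `exists_leviEquiv`, `polar_localPairing_levi`, **`localSchrodinger_eq_levi`** (on the nose), `implements_iff_levi`.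
* §2 the transported elements `⟨(k π(m) k⁻¹, M)⟩`: `levi_transport_mem`, ★★ **`exists_leviTransportHom`** (a homomorphism `S̃p_ψ(β_{T″}) →* S̃p_ψ(β_{T′})` with `π ∘ τ = Ad(k) ∘ π` and THE SAME
  Weil operators `ω(τ m) = ω(m)` — as an existential, no definition introduced).
* §3 Lagrangians: `map_eq_of_forall_mem` (an automorphism mapping `ℓ` into `ℓ` maps it ONTO `ℓ`, finite dimension), `map_symm_eq_of_map_eq`, `map_lagrangianY_levi` (`k ℓ_Y = ℓ_Y`),
  **`map_conj_eq_of_map_eq`** (movers of `ℓ` onto `ℓ′` go to movers under `Ad(k)` when `k ℓ = ℓ`, `k ℓ′ = ℓ′`).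
* §4 the doubled instance `S_v = S₀ ⊕ S₀` (same block twice, ★ `e₂`): `mulVec_blockDiag_apply_inl_eq_inr`, **`map_deltaLagrangian_levi_blockDiag`** (`k ℓ_Δ = ℓ_Δ`).
[MoeglinVignerasWaldspurger1987, Chap. 2 I.4, II.1] [Weil1964, n° 5, n° 34] [Kudla1994, §3] [HarrisKudlaSweet1996, §1 (1.9)–(1.11)].
HONEST LABEL.  Count-neutral helper; `HC_CM` is proved only modulo the 7 printed citations (2 remaining named inputs: hLiu418 = `stmt-HodgeConjecture-24832`,
h413 = `stmt-HodgeConjecture-24833`) until rung 0 closes.  NOT here: the unitary side (`ι′(ψ_T g) = P·(k_S ι″(g) k_S⁻¹)·P⁻¹`, brick (nat-1)) and the rigidity instance ((nat-2)).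

## References
* [MoeglinVignerasWaldspurger1987] C. Mœglin, M.-F. Vignéras, J.-L. Waldspurger, LNM 1291 (1987), Chap. 2 I.4, II.1 (A)–(B).
* [Weil1964] A. Weil, *Sur certains groupes d'opérateurs unitaires*, Acta Math. 111 (1964), n° 5 p. 150, n° 34 p. 182.
* [Kudla1994] S. Kudla, Israel J. Math. 87 (1994), §3.   * [HarrisKudlaSweet1996] M. Harris, S. Kudla, W. Sweet, J. AMS 9 (1996), §1 (1.9)–(1.11).
-/

set_option autoImplicit false
set_option linter.dupNamespace false -- the mandated namespace repeats `HodgeConjecture.HodgeConjecture`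

noncomputable section

open scoped Matrix
open NumberField IsDedekindDomain Matrix
open Literature.RepresentationTheory.HeisenbergGroup
open Literature.NumberTheory.Automorphic Literature.NumberTheory.Automorphic.UnitaryGroup
open Literature.NumberTheory.GelbartRogawski1991.UnitaryDualPair.LocalSplitting

namespace Summit.HodgeConjecture.HodgeConjecture.Cruxes.HLiu418.K2LiuLeviMatrixModelTransport

variable (F : Type) [Field F] [NumberField F] (v : HeightOneSpectrum (𝓞 F)) (N : ℕ)

/-! ## §1 Pairings and Schrödinger models of `T′` and `T″` with `T′_v·S_v = T″_v` -/

/-- `(T′·S)_v = T′_v · S_v` — a rational `S` with `T′·S = T″` gives the hypothesis `hT` below. [folklore] -/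
theorem localGram_mul (T' S : Matrix (Fin N) (Fin N) F) : localGram F N (T' * S) v = localGram F N T' v * S.map (algebraMap F (v.adicCompletion F)) := by
  simp only [localGram, Matrix.map_mul]

/-- **`β_{T′}(x, S_v y) = β_{T″}(x, y)`** when `T′_v·S_v = T″_v`. [cite: Weil1964, n° 34, p. 182] -/
theorem localPairing_mulVec (T' T'' : Matrix (Fin N) (Fin N) F) (Sv : Matrix (Fin N) (Fin N) (v.adicCompletion F)) (hT : localGram F N T' v * Sv = localGram F N T'' v)
    (x y : Fin N → v.adicCompletion F) : localPairing F N T' v x (Sv *ᵥ y) = localPairing F N T'' v x y := by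
  rw [localPairing, localPairing, Matrix.toLinearMap₂'_apply', Matrix.toLinearMap₂'_apply', Matrix.mulVec_mulVec, hT]

/-- **a Levi-type automorphism `k = 1 × S_v` exists**: `k (x, y) = (x, S_v y)` for an invertible `S_v`. [cite: Weil1964, n° 34, p. 182] -/
theorem exists_leviEquiv (Sv : Matrix (Fin N) (Fin N) (v.adicCompletion F)) (hSv : IsUnit Sv.det) :
    ∃ k : ((Fin N → v.adicCompletion F) × (Fin N → v.adicCompletion F)) ≃ₗ[v.adicCompletion F] ((Fin N → v.adicCompletion F) × (Fin N → v.adicCompletion F)),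
      ∀ w, k w = (w.1, Sv *ᵥ w.2) := by
  refine ⟨(LinearEquiv.refl (v.adicCompletion F) (Fin N → v.adicCompletion F)).prodCongr (Matrix.toLinearEquiv' Sv (Sv.invertibleOfIsUnitDet hSv)), fun w => ?_⟩
  rw [LinearEquiv.prodCongr_apply, LinearEquiv.refl_apply]
  refine Prod.ext rfl ?_
  change ((Matrix.toLinearEquiv' Sv (Sv.invertibleOfIsUnitDet hSv) : (Fin N → v.adicCompletion F) →ₗ[v.adicCompletion F] (Fin N → v.adicCompletion F)) w.2) = Sv *ᵥ w.2
  rw [Matrix.toLinearEquiv'_apply, Matrix.toLin'_apply]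

section Levi

variable (T' T'' : Matrix (Fin N) (Fin N) F) (Sv : Matrix (Fin N) (Fin N) (v.adicCompletion F)) (hT : localGram F N T' v * Sv = localGram F N T'' v)
  (k : ((Fin N → v.adicCompletion F) × (Fin N → v.adicCompletion F)) ≃ₗ[v.adicCompletion F] ((Fin N → v.adicCompletion F) × (Fin N → v.adicCompletion F)))
  (hk : ∀ w, k w = (w.1, Sv *ᵥ w.2))

include hT hk in
/-- **`k` is an isometry `polar β_{T″} → polar β_{T′}`**. [cite: Weil1964, n° 5, p. 150; n° 34, p. 182] -/
theorem polar_localPairing_levi (p q : (Fin N → v.adicCompletion F) × (Fin N → v.adicCompletion F)) :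
    polar (localPairing F N T' v) (k p) (k q) = polar (localPairing F N T'' v) p q := by
  rw [polar_apply, polar_apply, hk, hk]
  exact localPairing_mulVec F v N T' T'' Sv hT p.1 q.2

include hk in
/-- **`ρ_{T″} = ρ_{T′} ∘ H(k)` ON THE NOSE on `𝒮(F_vᴺ)`**: the Schrödinger operator of `((x, y), t)` for `β_{T″}` is that of `((x, S_v y), t)` for `β_{T′}` — the same formula
`Φ ↦ ψ(t + β_{T′}(u, S_v y)) Φ(u + x)`. [cite: MoeglinVignerasWaldspurger1987, Chap. 2 I.4 Exemple (1)] [cite: Weil1964, n° 34, p. 182] -/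
theorem localSchrodinger_eq_levi (h : Heisenberg (polar (localPairing F N T'' v))) :
    localSchrodinger F N T'' v h = localSchrodinger F N T' v (Heisenberg.mapEquiv k (polar_localPairing_levi F v N T' T'' Sv hT k hk) h) := by
  refine LinearMap.ext fun f => Subtype.ext (funext fun u => ?_)
  change ((schrodingerSB _ _ _ _ h f : SchwartzBruhat _) : _ → ℂ) u = ((schrodingerSB _ _ _ _ _ f : SchwartzBruhat _) : _ → ℂ) u
  rw [schrodingerSB_apply, schrodingerSB_apply, Heisenberg.mapEquiv_t, Heisenberg.mapEquiv_v, hk, localPairing_mulVec F v N T' T'' Sv hT]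

/-- **same-space transport of implementers**: `M` implements `g` for `ρ_{T″}` iff it implements `k g k⁻¹` for `ρ_{T′}` (★ `implements_iff_implements_symplecticConj`).
[cite: MoeglinVignerasWaldspurger1987, Chap. 2 II.1 (A)–(B)] -/
theorem implements_iff_levi (g : LocalSp F N T'' v) (M : SchwartzBruhat (Fin N → v.adicCompletion F) ≃ₗ[ℂ] SchwartzBruhat (Fin N → v.adicCompletion F)) :
    Implements (localSchrodinger F N T'' v) (ofSymplectic _ g) M ↔
      Implements (localSchrodinger F N T' v) (ofSymplectic _ (symplecticConj k (polar_localPairing_levi F v N T' T'' Sv hT k hk) g)) M :=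
  implements_iff_implements_symplecticConj _ (polar_localPairing_levi F v N T' T'' Sv hT k hk) (localSchrodinger_eq_levi F v N T' T'' Sv hT k hk) g M

/-! ## §2 The transported elements `(k π(m) k⁻¹, M)` of `S̃p_ψ(β_{T′})` -/

/-- **`(k π(m) k⁻¹, M) ∈ S̃p_ψ(β_{T′})`** for `m = (π(m), M) ∈ S̃p_ψ(β_{T″})`. [cite: MoeglinVignerasWaldspurger1987, Chap. 2 II.1 (A)–(B)] -/
theorem levi_transport_mem (m : LocalMp F N T'' v) :
    (symplecticConj k (polar_localPairing_levi F v N T' T'' Sv hT k hk) m.1.1, m.1.2) ∈ MpPsi (localSchrodinger F N T' v) := by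
  rw [mem_MpPsi]
  exact (implements_iff_levi F v N T' T'' Sv hT k hk m.1.1 m.1.2).1 ((mem_MpPsi _ _).1 m.2)

set_option maxHeartbeats 800000 in -- the `MpPsi` pair carrier over `symplecticConj` unfolds slowly (cf. ★ `LocalScaleModelTransport.scaleTransportElt_mul`: 400000)
/-- **THE TRANSPORT IS A HOMOMORPHISM `S̃p_ψ(β_{T″}) →* S̃p_ψ(β_{T′})` WITH THE SAME OPERATORS**: there is a group homomorphism `τ` with `π(τ m) = k π(m) k⁻¹` and `ω(τ m) = ω(m)` for all `m`
(an existential over `MonoidHom`, so that no definition is introduced; the witness is `m ↦ (k π(m) k⁻¹, M)`). [cite: MoeglinVignerasWaldspurger1987, Chap. 2 II.1 (A)–(B)] -/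
theorem exists_leviTransportHom :
    ∃ τ : LocalMp F N T'' v →* LocalMp F N T' v,
      (∀ m, MpPsi.proj _ (τ m) = symplecticConj k (polar_localPairing_levi F v N T' T'' Sv hT k hk) (MpPsi.proj _ m)) ∧
      ∀ m, MpPsi.toRep _ (τ m) = MpPsi.toRep _ m := by
  have hmem := levi_transport_mem F v N T' T'' Sv hT k hk
  let f : LocalMp F N T'' v → LocalMp F N T' v := fun m => ⟨(symplecticConj k (polar_localPairing_levi F v N T' T'' Sv hT k hk) m.1.1, m.1.2), hmem m⟩
  have hf : ∀ m, ((f m : LocalMp F N T' v) : LocalSp F N T' v × (SchwartzBruhat (Fin N → v.adicCompletion F) ≃ₗ[ℂ] SchwartzBruhat (Fin N → v.adicCompletion F))) =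
      (symplecticConj k (polar_localPairing_levi F v N T' T'' Sv hT k hk) m.1.1, m.1.2) := fun m => rfl
  have h2 : ∀ m m', f (m * m') = f m * f m' := fun m m' => Subtype.ext (by
    rw [hf, Subgroup.coe_mul, Subgroup.coe_mul, hf, hf, Prod.fst_mul, Prod.snd_mul, map_mul, Prod.mk_mul_mk])
  refine ⟨MonoidHom.mk' f h2, fun m => ?_, fun m => ?_⟩
  · rw [MpPsi.proj_apply, MpPsi.proj_apply, MonoidHom.mk'_apply, hf]
  · refine LinearMap.ext fun φ => ?_
    rw [MpPsi.toRep_apply, MpPsi.toRep_apply, MonoidHom.mk'_apply, hf]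

end Levi

/-! ## §3 Lagrangians: automorphisms mapping `ℓ` into `ℓ` map it onto `ℓ`; `k ℓ_Y = ℓ_Y`; movers go to movers -/

/-- a linear AUTOMORPHISM of a finite-dimensional space mapping `ℓ` into `ℓ` maps `ℓ` ONTO `ℓ`. [folklore] -/
theorem map_eq_of_forall_mem {K : Type*} [Field K] {W : Type*} [AddCommGroup W] [Module K W] [FiniteDimensional K W] (k : W ≃ₗ[K] W) (ℓ : Submodule K W)
    (h : ∀ p ∈ ℓ, k p ∈ ℓ) : ℓ.map (k : W →ₗ[K] W) = ℓ :=
  Submodule.eq_of_le_of_finrank_eq (Submodule.map_le_iff_le_comap.2 fun p hp => h p hp) (LinearEquiv.finrank_map_eq k ℓ)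

/-- … and then its inverse does too. [folklore] -/
theorem map_symm_eq_of_map_eq {K : Type*} [Field K] {W : Type*} [AddCommGroup W] [Module K W] (k : W ≃ₗ[K] W) (ℓ : Submodule K W)
    (h : ℓ.map (k : W →ₗ[K] W) = ℓ) : ℓ.map (k.symm : W →ₗ[K] W) = ℓ := by
  conv_lhs => rw [← h]
  rw [← Submodule.map_comp]
  have hc : (k.symm : W →ₗ[K] W).comp (k : W →ₗ[K] W) = LinearMap.id := LinearMap.ext fun x => k.symm_apply_apply x
  rw [hc, Submodule.map_id]

/-- **`k` preserves `ℓ_Y = 0 × Y_v`**. [cite: HarrisKudlaSweet1996, §1 (1.11)] -/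
theorem map_lagrangianY_levi (Sv : Matrix (Fin N) (Fin N) (v.adicCompletion F))
    (k : ((Fin N → v.adicCompletion F) × (Fin N → v.adicCompletion F)) ≃ₗ[v.adicCompletion F] ((Fin N → v.adicCompletion F) × (Fin N → v.adicCompletion F)))
    (hk : ∀ w, k w = (w.1, Sv *ᵥ w.2)) :
    (lagrangianY F N v).map (k : _ →ₗ[v.adicCompletion F] _) = lagrangianY F N v := by
  refine map_eq_of_forall_mem k _ fun p hp => ?_
  simp only [lagrangianY, Submodule.mem_prod, Submodule.mem_bot, Submodule.mem_top, and_true] at hp ⊢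
  rw [hk]
  exact hp

/-- **MOVERS GO TO MOVERS**: for a linear automorphism `k` of `𝕎_v` preserving `ℓ` and `ℓ′`, if `g` maps `ℓ` onto `ℓ′` then so does `k g k⁻¹` (the underlying map of ★ `symplecticConj k _ g`
is `k.symm ≪≫ₗ g ≪≫ₗ k`). [cite: HarrisKudlaSweet1996, §1 (1.11)] -/
theorem map_conj_eq_of_map_eq {K : Type*} [Field K] {W : Type*} [AddCommGroup W] [Module K W] (k g : W ≃ₗ[K] W) (ℓ ℓ' : Submodule K W)
    (hℓ : ℓ.map (k : W →ₗ[K] W) = ℓ) (hℓ' : ℓ'.map (k : W →ₗ[K] W) = ℓ') (hg : ℓ.map (g : W →ₗ[K] W) = ℓ') :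
    ℓ.map ((k.symm ≪≫ₗ g ≪≫ₗ k : W ≃ₗ[K] W) : W →ₗ[K] W) = ℓ' := by
  rw [LinearEquiv.coe_trans, LinearEquiv.coe_trans, Submodule.map_comp, Submodule.map_comp, map_symm_eq_of_map_eq k ℓ hℓ, hg, hℓ']

/-! ## §4 The doubled instance: `S_v = S₀ ⊕ S₀` preserves `ℓ_Δ` -/

/-- the block-diagonal matrix `S₀ ⊕ S₀` (in the doubling enumeration ★ `e₂`) acts on a `Δ`-diagonal vector diagonally: `(S y)_{inl i} = (S y)_{inr i}` when `y_{inl j} = y_{inr j}`.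
[cite: HarrisKudlaSweet1996, §1 (1.9)–(1.11)] -/
theorem mulVec_blockDiag_apply_inl_eq_inr {K : Type*} [CommRing K] {n : ℕ} (S₀ : Matrix (Fin n) (Fin n) K) (y : Fin (n + n) → K)
    (hy : ∀ i : Fin n, y (e₂ n (Sum.inl i)) = y (e₂ n (Sum.inr i))) (i : Fin n) :
    (Matrix.reindex (e₂ n) (e₂ n) (Matrix.fromBlocks S₀ 0 0 S₀) *ᵥ y) (e₂ n (Sum.inl i)) =
      (Matrix.reindex (e₂ n) (e₂ n) (Matrix.fromBlocks S₀ 0 0 S₀) *ᵥ y) (e₂ n (Sum.inr i)) := by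
  simp only [Matrix.mulVec, dotProduct, Matrix.reindex_apply, Matrix.submatrix_apply, Equiv.symm_apply_apply]
  rw [← (e₂ n).sum_comp, ← (e₂ n).sum_comp]
  simp only [Equiv.symm_apply_apply, Fintype.sum_sum_type, Matrix.fromBlocks_apply₁₁, Matrix.fromBlocks_apply₁₂, Matrix.fromBlocks_apply₂₁,
    Matrix.fromBlocks_apply₂₂, Matrix.zero_apply, zero_mul, Finset.sum_const_zero, add_zero, zero_add]
  exact Finset.sum_congr rfl fun j _ => by rw [hy j]

/-- **`k = 1 × (S₀ ⊕ S₀)` PRESERVES `ℓ_Δ`**. [cite: HarrisKudlaSweet1996, §1 (1.11)] -/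
theorem map_deltaLagrangian_levi_blockDiag {n : ℕ} (S₀ : Matrix (Fin n) (Fin n) (v.adicCompletion F))
    (k : ((Fin (n + n) → v.adicCompletion F) × (Fin (n + n) → v.adicCompletion F)) ≃ₗ[v.adicCompletion F]
      ((Fin (n + n) → v.adicCompletion F) × (Fin (n + n) → v.adicCompletion F)))
    (hk : ∀ w, k w = (w.1, Matrix.reindex (e₂ n) (e₂ n) (Matrix.fromBlocks S₀ 0 0 S₀) *ᵥ w.2)) :
    (deltaLagrangian F v n).map (k : _ →ₗ[v.adicCompletion F] _) = deltaLagrangian F v n := by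
  refine map_eq_of_forall_mem k _ fun p hp => ?_
  rw [hk]
  exact fun i => ⟨(hp i).1, mulVec_blockDiag_apply_inl_eq_inr S₀ p.2 (fun j => (hp j).2) i⟩

end Summit.HodgeConjecture.HodgeConjecture.Cruxes.HLiu418.K2LiuLeviMatrixModelTransport

end
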